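import Literature.MathematicalPhysics.QuantumLattice.HubbardBondPairDecaySharp
import Literature.MathematicalPhysics.QuantumLattice.HubbardBondPairDecaySharpTTPrime
import HarnessLib

/-!
# Koma–Tasaki decay for general `n`-fermion pairing operators (footnote [10]), sharp constants

Trunk T-QLATTICE (family `hubbard`; consumer: the cell file
`Summits/HubbardSuperconductivity/HubbardLadder/Bounds/MultiFermionEtaLineEuclid.lean`;
companions: `HubbardBondPairDecaySharp.lean` (`n = 2`, singlet bond pairs) and
`HubbardBondPairDecaySharpTTPrime.lean` (their `t–t'` twin)).

Koma–Tasaki, PRL 68 (1992) 3248, footnote [10]: "It is easy to prove a bound similar to (2) for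
more complicated pairing function `⟨(P_x)† P_y⟩` with `P_x = c_{x,σ₁} c_{x+δ₂,σ₂} ⋯ c_{x+δ_n,σ_n}`
where `δ₂, …, δ_n` are fixed lattice vectors and `σ₁, …, σ_n` are fixed spin indices. This allows
us to rule out the condensation of various types of electron pairings." This file proves that
bound with EXPLICIT constants, for every `n`, for the grand-canonical Hubbard model on `(ℤ/Lℤ)²`
with nearest-neighbour hopping and for the `t–t'` model (note 9; Xu et al. 2024, eq. (1)): an
`n`-fermion product carries gauge charge exactly `n` under a site gauge (eq. (8)) that is FLAT on
its support, so with the printed hopping norm (`‖c†_u c_v + h.c.‖ = 1`) and the flat Euclidean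
truncated logarithmic dipole of the companions (McBryan–Spencer coefficients `2π` / `4π`)

* `norm_thermalCorr_fermionProduct_le_exp_sharp` — a priori bound on an arbitrary finite graph:
  `|⟨(P)† P'⟩_β| ≤ e^{-Σ_{u ∈ P} φ_u + Σ_{v ∈ P'} φ_v} exp[β|t| Σ_a Σ_b [a∼b](cosh(φ_a-φ_b)-1)]`
  (`‖P‖ ≤ 1`), and `norm_thermalCorr_fermionProduct_le_exp_two_graphs` (two hopping graphs);
* `norm_thermalCorr_multiFermion_le_sharp` — for `P_x = c_{x+δ₁,σ₁} ⋯ c_{x+δ_n,σ_n}` with steps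
  `δ_i ∈ {0, ±e₁, ±e₂}` and arbitrary spins, and any second such operator `P'_y` of the same
  length `n`: `|⟨(P_x)† P'_y⟩_{β,L}| ≤ K(q) 5^f (dist(x,y)+1)^{-f}`,
  `f = 2nq - 4πβ|t|q² ≥ 0`, `K(q) = exp[2β|t|(2πq²+76q²+544q⁴e^{2q²})]`, every `q ≥ 0`,
  uniformly in `L`, all `U`, `μ`; at `q = n/(4πβ|t|)` the exponent is `n²/(4πβ|t|) = n²T/(4π|t|)`
  (`n = 1`: the one-particle exponent `T/(4π|t|)`; `n = 2`: the pair exponent `T/(π|t|)`;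
  `n = 4`: electron quartets, charge `4e`, exponent `4T/(π|t|)`);
* `norm_thermalCorr_multiFermion_ttPrime_le_sharp` — the same for `H_{t,t'}(U) - μN` with
  `|t|` replaced by `|t| + 2|t'|` in the exponent and the two-graph constant `K_{t,t'}(q)`.

Sources: T. Koma, H. Tasaki, PRL 68 (1992) 3248 (= arXiv:cond-mat/9709068), Theorem, eqs.
(5)–(13), note 9, footnote [10]; O. A. McBryan, T. Spencer, Commun. Math. Phys. 53 (1977) 299;
E. Berg, E. Fradkin, S. A. Kivelson, Nature Phys. 5 (2009) 830 (charge-`4e` condensates);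
H. Xu et al., Science 384 (2024) eadh7691, eq. (1) (the `t–t'` model).

## Mathlib / tree search

Tree: `siteGauge_mul_annihilation_mul`, `siteGauge_mul_creation_mul`, `siteGauge_conj_mul`,
`siteGauge_mul_siteGauge_neg`, `norm_annihilation_le_one`, `isUnit_siteGauge`, `siteGauge_inv`,
`siteGauge_conj_hamiltonianWith_add_conjTranspose`, `isHermitian_hamiltonianWith`
(`HubbardGaugeBound`); `norm_gibbsState_le_of_gauge` (`HubbardHubbardModelPairDecayProofs`);
`norm_hoppingPerturbation_le_sharp` (`HubbardGaugeBoundSharp`); `le_rpow_euclid_of_apriori_flat`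
(`HubbardBondPairDecaySharp`); `le_rpow_euclid_two_graphs_of_apriori_flat`,
`hubbardTorusTT'_sub_chemicalPotential` (`HubbardBondPairDecaySharpTTPrime`,
`HubbardGaugeBoundTTPrime`); `torusNorm_proj_le_one`, `apply_mem_insert_unitSteps`.
Mathlib: `Matrix.l2_opNorm_diagonal`, `List.mem_ofFn`, `List.length_ofFn`.

## Design notes

No statement of the tree is changed. `fermionProduct l` is the ordered product of annihilation
operators along a list of orbitals `(site, spin)`; `multiFermion δ σ L x` is Koma–Tasaki's `P_x`
on the torus. The flatness region `{u : |u-x|₂² ≤ 1}` of the companions' dipole is why the steps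
are restricted to `{0, ±e₁, ±e₂}`; the exponent does not depend on the steps or the spins.
-/

noncomputable section

namespace Literature.MathematicalPhysics.QuantumLattice

open Matrix Finset NormedSpace Literature.Probability.LatticeModels
  Literature.Barriers.HubbardSuperconductivity
open scoped Matrix.Norms.L2Operator ComplexOrder

/-! ### `n`-fermion products and their gauge charge -/

section Graph

variable {Λ : Type*} [LinearOrder Λ] [Fintype Λ]

/-- Koma–Tasaki's general pairing operator (footnote [10]): the ordered product
`c_{u₁σ₁} c_{u₂σ₂} ⋯ c_{u_nσ_n}` of annihilation operators along a list of orbitals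
`[(u₁,σ₁), …, (u_n,σ_n)]` (the empty product is `1`). [cite: KomaTasakiPRL1992, footnote [10]] -/
def fermionProduct : List (Λ × Fin 2) → Matrix (Finset (Orb Λ)) (Finset (Orb Λ)) ℂ
  | [] => 1
  | p :: l => annihilation (orb p.1 p.2) * fermionProduct l

/-- `fermionProduct [] = 1`. [cite: KomaTasakiPRL1992, footnote [10]] -/
@[simp] theorem fermionProduct_nil : fermionProduct ([] : List (Λ × Fin 2)) = 1 := rfl

/-- `fermionProduct ((u,σ) :: l) = c_{uσ} · fermionProduct l`. [cite: KomaTasakiPRL1992, footnote [10]] -/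
@[simp] theorem fermionProduct_cons (p : Λ × Fin 2) (l : List (Λ × Fin 2)) :
    fermionProduct (p :: l) = annihilation (orb p.1 p.2) * fermionProduct l := rfl

/-- The gauge weight `Σ_i φ(u_i)` of a list of orbitals under the site potential `φ`
(eq. (8): each `c_{u_iσ_i}` picks up `e^{φ(u_i)}`). [cite: KomaTasakiPRL1992, eq. (8)] -/
def gaugeWeight (φ : Λ → ℝ) (l : List (Λ × Fin 2)) : ℝ := (l.map fun p => φ p.1).sum

omit [LinearOrder Λ] [Fintype Λ] in
/-- `gaugeWeight φ [] = 0`. [cite: KomaTasakiPRL1992, eq. (8)] -/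
@[simp] theorem gaugeWeight_nil (φ : Λ → ℝ) : gaugeWeight φ ([] : List (Λ × Fin 2)) = 0 := by
  simp [gaugeWeight]

omit [LinearOrder Λ] [Fintype Λ] in
/-- `gaugeWeight φ ((u,σ) :: l) = φ u + gaugeWeight φ l`. [cite: KomaTasakiPRL1992, eq. (8)] -/
@[simp] theorem gaugeWeight_cons (φ : Λ → ℝ) (p : Λ × Fin 2) (l : List (Λ × Fin 2)) :
    gaugeWeight φ (p :: l) = φ p.1 + gaugeWeight φ l := by
  simp [gaugeWeight]

/-- **Eq. (8) for an `n`-fermion product**: `G(φ) (c_{u₁σ₁} ⋯ c_{u_nσ_n}) G(φ)⁻¹ =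
e^{Σ_i φ(u_i)} c_{u₁σ₁} ⋯ c_{u_nσ_n}`. [cite: KomaTasakiPRL1992, eq. (8) and footnote [10]] -/
theorem siteGauge_mul_fermionProduct_mul (φ : Λ → ℝ) (l : List (Λ × Fin 2)) :
    siteGauge φ * fermionProduct l * siteGauge (-φ) =
      ((Real.exp (gaugeWeight φ l) : ℝ) : ℂ) • fermionProduct l := by
  induction l with
  | nil =>
      rw [fermionProduct_nil, Matrix.mul_one, siteGauge_mul_siteGauge_neg, gaugeWeight_nil,
        Real.exp_zero, Complex.ofReal_one, one_smul]
  | cons p l ih =>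
      rw [fermionProduct_cons, siteGauge_conj_mul, siteGauge_mul_annihilation_mul, ih,
        smul_mul_smul, ← Complex.ofReal_mul, ← Real.exp_add, gaugeWeight_cons]

/-- `(c_{uσ} · P)† = P† · c†_{uσ}`. [cite: KomaTasakiPRL1992, footnote [10]] -/
theorem fermionProduct_conjTranspose_cons (p : Λ × Fin 2) (l : List (Λ × Fin 2)) :
    (fermionProduct (p :: l))ᴴ = (fermionProduct l)ᴴ * creation (orb p.1 p.2) := by
  rw [fermionProduct_cons, conjTranspose_mul, annihilation_conjTranspose]

/-- **Eq. (8) for the adjoint of an `n`-fermion product**: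
`G(φ) (c_{u₁σ₁} ⋯ c_{u_nσ_n})† G(φ)⁻¹ = e^{-Σ_i φ(u_i)} (c_{u₁σ₁} ⋯ c_{u_nσ_n})†`.
[cite: KomaTasakiPRL1992, eq. (8) and footnote [10]] -/
theorem siteGauge_mul_fermionProduct_conjTranspose_mul (φ : Λ → ℝ) (l : List (Λ × Fin 2)) :
    siteGauge φ * (fermionProduct l)ᴴ * siteGauge (-φ) =
      ((Real.exp (-gaugeWeight φ l) : ℝ) : ℂ) • (fermionProduct l)ᴴ := by
  induction l with
  | nil =>
      rw [fermionProduct_nil, conjTranspose_one, Matrix.mul_one, siteGauge_mul_siteGauge_neg,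
        gaugeWeight_nil, neg_zero, Real.exp_zero, Complex.ofReal_one, one_smul]
  | cons p l ih =>
      rw [fermionProduct_conjTranspose_cons, siteGauge_conj_mul, ih, siteGauge_mul_creation_mul,
        smul_mul_smul, ← Complex.ofReal_mul, ← Real.exp_add, gaugeWeight_cons]
      have h : -gaugeWeight φ l + -φ p.1 = -(φ p.1 + gaugeWeight φ l) := by ring
      rw [h]

/-- **Koma–Tasaki eq. (8) for the general pairing observable `A = (P)† P'`** with
`P = c_{u₁σ₁} ⋯ c_{u_nσ_n}`, `P' = c_{v₁τ₁} ⋯ c_{v_mτ_m}`: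
`G(φ) A G(φ)⁻¹ = exp[-Σ_i φ(u_i) + Σ_j φ(v_j)] A`. [cite: KomaTasakiPRL1992, eq. (8) and footnote [10]] -/
theorem siteGauge_mul_fermionProductCorr_mul (φ : Λ → ℝ) (l l' : List (Λ × Fin 2)) :
    siteGauge φ * ((fermionProduct l)ᴴ * fermionProduct l') * siteGauge (-φ) =
      ((Real.exp (-gaugeWeight φ l + gaugeWeight φ l') : ℝ) : ℂ) •
        ((fermionProduct l)ᴴ * fermionProduct l') := by
  rw [siteGauge_conj_mul, siteGauge_mul_fermionProduct_conjTranspose_mul,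
    siteGauge_mul_fermionProduct_mul, smul_mul_smul, ← Complex.ofReal_mul, ← Real.exp_add]

/-- `‖c_{u₁σ₁} ⋯ c_{u_nσ_n}‖ ≤ 1` (`‖c‖ ≤ 1`, after eq. (11)). [cite: KomaTasakiPRL1992, after eq. (11)] -/
theorem norm_fermionProduct_le_one (l : List (Λ × Fin 2)) :
    ‖(fermionProduct l : Matrix (Finset (Orb Λ)) (Finset (Orb Λ)) ℂ)‖ ≤ 1 := by
  induction l with
  | nil =>
      rw [fermionProduct_nil, ← Matrix.diagonal_one, Matrix.l2_opNorm_diagonal,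
        pi_norm_le_iff_of_nonneg zero_le_one]
      intro i
      simp
  | cons p l ih =>
      rw [fermionProduct_cons]
      exact (norm_mul_le _ _).trans
        (mul_le_one₀ (norm_annihilation_le_one _) (norm_nonneg _) ih)

/-- `‖(P)† P'‖ ≤ 1` for two fermion products (Koma–Tasaki use `‖A‖ = 1` in eq. (10)).
[cite: KomaTasakiPRL1992, eq. (10) and footnote [10]] -/
theorem norm_fermionProductCorr_le_one (l l' : List (Λ × Fin 2)) :
    ‖((fermionProduct l)ᴴ * fermionProduct l' : Matrix (Finset (Orb Λ)) (Finset (Orb Λ)) ℂ)‖ ≤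
      1 := by
  refine (norm_mul_le _ _).trans ?_
  rw [l2_opNorm_conjTranspose]
  exact mul_le_one₀ (norm_fermionProduct_le_one l) (norm_nonneg _) (norm_fermionProduct_le_one l')

variable (G : SimpleGraph Λ) [DecidableRel G.Adj]

/-- **Koma–Tasaki's a priori bound for general pairing operators, printed constant** (eqs.
(6)–(12) before the choice of `φ`, footnote [10]; `‖c†_u c_v + c†_v c_u‖ = 1`): on an arbitrary
finite graph, for every real site function `φ`, `β ≥ 0` and orbital lists `l`, `l'`,
`|⟨(P_l)† P_{l'}⟩_β| ≤ exp[-Σ_{(u,σ)∈l} φ_u + Σ_{(v,τ)∈l'} φ_v] exp[β|t| Σ_a Σ_b [a∼b](cosh(φ_a-φ_b)-1)]`.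
[cite: KomaTasakiPRL1992, eqs. (6)–(12) and footnote [10]] -/
theorem norm_thermalCorr_fermionProduct_le_exp_sharp (t U μ : ℝ) {β : ℝ} (hβ : 0 ≤ β)
    (φ : Λ → ℝ) (l l' : List (Λ × Fin 2)) :
    ‖(hamiltonianWith G t U μ).thermalCorr β (fermionProduct l)ᴴ (fermionProduct l')‖ ≤
      Real.exp (-gaugeWeight φ l + gaugeWeight φ l') *
        Real.exp (β * (|t| * ∑ a : Λ, ∑ b : Λ,
          if G.Adj a b then (Real.cosh (φ a - φ b) - 1) else 0)) := by
  set H : Matrix (Finset (Orb Λ)) (Finset (Orb Λ)) ℂ := hamiltonianWith G t U μ with hH_def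
  set A : Matrix (Finset (Orb Λ)) (Finset (Orb Λ)) ℂ := (fermionProduct l)ᴴ * fermionProduct l'
    with hA_def
  set V : Matrix (Finset (Orb Λ)) (Finset (Orb Λ)) ℂ :=
    -(t : ℂ) • hoppingForm G (fun a b => Real.cosh (φ a - φ b) - 1) with hV_def
  set c : ℝ := |t| * ∑ a : Λ, ∑ b : Λ,
    if G.Adj a b then (Real.cosh (φ a - φ b) - 1) else 0 with hc_def
  set κ : ℝ := Real.exp (-gaugeWeight φ l + gaugeWeight φ l') with hκ_def
  have hH : H.IsHermitian := isHermitian_hamiltonianWith G t U μ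
  have hD : IsUnit (siteGauge φ) := isUnit_siteGauge φ
  have hA : siteGauge φ * A * (siteGauge φ)⁻¹ = ((κ : ℝ) : ℂ) • A := by
    rw [siteGauge_inv]
    exact siteGauge_mul_fermionProductCorr_mul φ l l'
  have hV : siteGauge φ * H * (siteGauge φ)⁻¹ + (siteGauge φ * H * (siteGauge φ)⁻¹)ᴴ =
      (2 : ℂ) • (H + V) := by
    rw [siteGauge_inv]
    exact siteGauge_conj_hamiltonianWith_add_conjTranspose G φ t U μ
  have hc : ‖V‖ ≤ c := norm_hoppingPerturbation_le_sharp G φ t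
  have h := norm_gibbsState_le_of_gauge hH hD hA hV hc hβ
  have hκ : ‖((κ : ℝ) : ℂ)‖ = κ := by
    rw [Complex.norm_real, Real.norm_of_nonneg (Real.exp_pos _).le]
  have hthermal : H.thermalCorr β (fermionProduct l)ᴴ (fermionProduct l') = gibbsState β H A :=
    rfl
  rw [hthermal]
  calc ‖gibbsState β H A‖
      ≤ ‖((κ : ℝ) : ℂ)‖ * ‖A‖ * Real.exp (β * c) := h
    _ ≤ ‖((κ : ℝ) : ℂ)‖ * 1 * Real.exp (β * c) := by
        gcongr
        exact norm_fermionProductCorr_le_one l l'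
    _ = κ * Real.exp (β * c) := by rw [hκ]; ring

variable (G₂ : SimpleGraph Λ) [DecidableRel G₂.Adj]

/-- **The a priori bound for general pairing operators and a two-graph hopping** (note 9,
footnote [10]): for `H = (H_{G}(t₁,U₁) - μ₁N) + (H_{G₂}(t₂,U₂) - μ₂N)`, every real `φ`, `β ≥ 0`,
`|⟨(P_l)† P_{l'}⟩_β| ≤ exp[-Σ_l φ + Σ_{l'} φ] exp[β(|t₁| Σ_a Σ_b [a∼₁b] + |t₂| Σ_a Σ_b [a∼₂b])(cosh(φ_a-φ_b)-1)]`.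
[cite: KomaTasakiPRL1992, eqs. (6)–(12), note 9 and footnote [10]] -/
theorem norm_thermalCorr_fermionProduct_le_exp_two_graphs (t₁ U₁ μ₁ t₂ U₂ μ₂ : ℝ) {β : ℝ}
    (hβ : 0 ≤ β) (φ : Λ → ℝ) (l l' : List (Λ × Fin 2)) :
    ‖(hamiltonianWith G t₁ U₁ μ₁ + hamiltonianWith G₂ t₂ U₂ μ₂).thermalCorr β
        (fermionProduct l)ᴴ (fermionProduct l')‖ ≤
      Real.exp (-gaugeWeight φ l + gaugeWeight φ l') *
        Real.exp (β * (|t₁| * (∑ a : Λ, ∑ b : Λ,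
            if G.Adj a b then (Real.cosh (φ a - φ b) - 1) else 0) +
          |t₂| * ∑ a : Λ, ∑ b : Λ,
            if G₂.Adj a b then (Real.cosh (φ a - φ b) - 1) else 0)) := by
  have h1 := siteGauge_conj_hamiltonianWith_add_conjTranspose G φ t₁ U₁ μ₁
  have h2 := siteGauge_conj_hamiltonianWith_add_conjTranspose G₂ φ t₂ U₂ μ₂
  set H₁ : Matrix (Finset (Orb Λ)) (Finset (Orb Λ)) ℂ := hamiltonianWith G t₁ U₁ μ₁ with hH₁
  set H₂ : Matrix (Finset (Orb Λ)) (Finset (Orb Λ)) ℂ := hamiltonianWith G₂ t₂ U₂ μ₂ with hH₂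
  set V₁ : Matrix (Finset (Orb Λ)) (Finset (Orb Λ)) ℂ :=
    -(t₁ : ℂ) • hoppingForm G (fun a b => Real.cosh (φ a - φ b) - 1) with hV₁
  set V₂ : Matrix (Finset (Orb Λ)) (Finset (Orb Λ)) ℂ :=
    -(t₂ : ℂ) • hoppingForm G₂ (fun a b => Real.cosh (φ a - φ b) - 1) with hV₂
  set A : Matrix (Finset (Orb Λ)) (Finset (Orb Λ)) ℂ := (fermionProduct l)ᴴ * fermionProduct l'
    with hA_def
  set c : ℝ := |t₁| * (∑ a : Λ, ∑ b : Λ,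
      if G.Adj a b then (Real.cosh (φ a - φ b) - 1) else 0) +
    |t₂| * ∑ a : Λ, ∑ b : Λ, if G₂.Adj a b then (Real.cosh (φ a - φ b) - 1) else 0 with hc_def
  set κ : ℝ := Real.exp (-gaugeWeight φ l + gaugeWeight φ l') with hκ_def
  have hH : (H₁ + H₂).IsHermitian :=
    (isHermitian_hamiltonianWith G t₁ U₁ μ₁).add (isHermitian_hamiltonianWith G₂ t₂ U₂ μ₂)
  have hD : IsUnit (siteGauge φ) := isUnit_siteGauge φ
  have hA : siteGauge φ * A * (siteGauge φ)⁻¹ = ((κ : ℝ) : ℂ) • A := by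
    rw [siteGauge_inv]
    exact siteGauge_mul_fermionProductCorr_mul φ l l'
  have hV : siteGauge φ * (H₁ + H₂) * (siteGauge φ)⁻¹ +
      (siteGauge φ * (H₁ + H₂) * (siteGauge φ)⁻¹)ᴴ = (2 : ℂ) • ((H₁ + H₂) + (V₁ + V₂)) := by
    rw [siteGauge_inv, Matrix.mul_add, Matrix.add_mul, conjTranspose_add]
    calc siteGauge φ * H₁ * siteGauge (-φ) + siteGauge φ * H₂ * siteGauge (-φ) +
          ((siteGauge φ * H₁ * siteGauge (-φ))ᴴ + (siteGauge φ * H₂ * siteGauge (-φ))ᴴ)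
        = (siteGauge φ * H₁ * siteGauge (-φ) + (siteGauge φ * H₁ * siteGauge (-φ))ᴴ) +
          (siteGauge φ * H₂ * siteGauge (-φ) + (siteGauge φ * H₂ * siteGauge (-φ))ᴴ) := by abel
      _ = (2 : ℂ) • (H₁ + V₁) + (2 : ℂ) • (H₂ + V₂) := by rw [h1, h2]
      _ = (2 : ℂ) • ((H₁ + H₂) + (V₁ + V₂)) := by module
  have hc : ‖V₁ + V₂‖ ≤ c :=
    (norm_add_le _ _).trans (add_le_add (norm_hoppingPerturbation_le_sharp G φ t₁)
      (norm_hoppingPerturbation_le_sharp G₂ φ t₂))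
  have h := norm_gibbsState_le_of_gauge hH hD hA hV hc hβ
  have hκ : ‖((κ : ℝ) : ℂ)‖ = κ := by
    rw [Complex.norm_real, Real.norm_of_nonneg (Real.exp_pos _).le]
  have hthermal : (H₁ + H₂).thermalCorr β (fermionProduct l)ᴴ (fermionProduct l') =
      gibbsState β (H₁ + H₂) A := rfl
  rw [hthermal]
  calc ‖gibbsState β (H₁ + H₂) A‖
      ≤ ‖((κ : ℝ) : ℂ)‖ * ‖A‖ * Real.exp (β * c) := h
    _ ≤ ‖((κ : ℝ) : ℂ)‖ * 1 * Real.exp (β * c) := by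
        gcongr
        exact norm_fermionProductCorr_le_one l l'
    _ = κ * Real.exp (β * c) := by rw [hκ]; ring

end Graph

/-! ### Torus forms for supports on which the potential is flat -/

section Torus

variable {L : ℕ} [NeZero L]

/-- The gauge weight of a torus orbital list `[(x₁,σ₁), …]` transported to the fermionic torus
is `Σ_i φ(x_i)`. [cite: KomaTasakiPRL1992, eq. (8)] -/
theorem gaugeWeight_map_ofTorusSite (φ : TorusSite 2 L → ℝ)
    (l : List (TorusSite 2 L × Fin 2)) :
    gaugeWeight (fun u => φ (FermionTorus.toTorusSite u))
        (l.map fun p => (FermionTorus.ofTorusSite p.1, p.2)) = (l.map fun p => φ p.1).sum := by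
  simp [gaugeWeight, List.map_map, Function.comp_def, FermionTorus.toTorusSite_ofTorusSite]

/-- A flat potential weighs a list by its length: if `φ(x_i) = c` for every entry then
`Σ_i φ(x_i) = (length) · c`. [folklore] -/
private theorem sum_map_eq_length_mul {α : Type*} (φ : α → ℝ) (c : ℝ) (l : List (α × Fin 2))
    (h : ∀ p ∈ l, φ p.1 = c) : (l.map fun p => φ p.1).sum = (l.length : ℝ) * c := by
  induction l with
  | nil => simp
  | cons p l ih =>
      rw [List.map_cons, List.sum_cons, List.length_cons, h p (by simp),
        ih (fun q hq => h q (by simp [hq]))]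
      push_cast
      ring

/-- The torus orbital list transported to the fermionic torus `FermionTorus 2 L`.
[cite: KomaTasakiPRL1992, footnote [10]] -/
def torusFermionProduct (l : List (TorusSite 2 L × Fin 2)) :
    Matrix (Finset (Orb (FermionTorus 2 L))) (Finset (Orb (FermionTorus 2 L))) ℂ :=
  fermionProduct (l.map fun p => (FermionTorus.ofTorusSite p.1, p.2))

/-- **The printed a priori bound on `(ℤ/Lℤ)²` for flat potentials** (footnote [10]): if `φ` is
constant (`= φ x`) on the sites of `l` and (`= φ y`) on the sites of `l'`, then for `β ≥ 0`
`|⟨(P_l)† P_{l'}⟩_{β,L}| ≤ e^{-|l| φ_x + |l'| φ_y} exp[β|t| Σ_a Σ_b [a∼b](cosh(φ_a-φ_b)-1)]`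
— an `n`-fermion product carries gauge charge exactly `n`.
[cite: KomaTasakiPRL1992, eqs. (6)–(12) and footnote [10]] -/
theorem norm_thermalCorr_fermionProduct_torus_le_exp_sharp (t U μ : ℝ) {β : ℝ} (hβ : 0 ≤ β)
    (φ : TorusSite 2 L → ℝ) (x y : TorusSite 2 L) (l l' : List (TorusSite 2 L × Fin 2))
    (hx : ∀ p ∈ l, φ p.1 = φ x) (hy : ∀ p ∈ l', φ p.1 = φ y) :
    ‖(hubbardTorusWith 2 L t U μ).thermalCorr β
        (torusFermionProduct l)ᴴ (torusFermionProduct l')‖ ≤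
      Real.exp (-((l.length : ℝ) * φ x) + (l'.length : ℝ) * φ y) * Real.exp (β * |t| *
        ∑ a : TorusSite 2 L, ∑ b : TorusSite 2 L,
          (if (torusGraph 2 L).Adj a b then (Real.cosh (φ a - φ b) - 1) else 0)) := by
  have key := norm_thermalCorr_fermionProduct_le_exp_sharp (fermionTorusGraph 2 L) t U μ hβ
    (fun u => φ (FermionTorus.toTorusSite u))
    (l.map fun p => (FermionTorus.ofTorusSite p.1, p.2))
    (l'.map fun p => (FermionTorus.ofTorusSite p.1, p.2))
  have hsumeq : (∑ u : FermionTorus 2 L, ∑ v : FermionTorus 2 L,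
      if (fermionTorusGraph 2 L).Adj u v then
        (Real.cosh (φ (FermionTorus.toTorusSite u) - φ (FermionTorus.toTorusSite v)) - 1)
      else 0) =
      ∑ a : TorusSite 2 L, ∑ b : TorusSite 2 L,
        if (torusGraph 2 L).Adj a b then (Real.cosh (φ a - φ b) - 1) else 0 := by
    refine Fintype.sum_equiv FermionTorus.equivTorusSite _ _ fun u => ?_
    refine Fintype.sum_equiv FermionTorus.equivTorusSite _ _ fun v => ?_
    simp [FermionTorus.equivTorusSite]
  rw [hsumeq, gaugeWeight_map_ofTorusSite, gaugeWeight_map_ofTorusSite,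
    sum_map_eq_length_mul φ (φ x) l hx, sum_map_eq_length_mul φ (φ y) l' hy] at key
  unfold torusFermionProduct
  refine Eq.trans_le ?_ (key.trans_eq ?_)
  · congr!
  · ring

/-- **The printed a priori bound for the `t–t'` model on `(ℤ/Lℤ)²`, flat potentials**
(note 9, footnote [10]): if `φ` is constant on the sites of `l` (`= φ x`) and of `l'` (`= φ y`),
then for `β ≥ 0` and all real `t, t', U, μ`:
`|⟨(P_l)† P_{l'}⟩_{β,L}| ≤ e^{-|l| φ_x + |l'| φ_y} exp[β(|t| Σ_{n.n.} + |t'| Σ_{diag})(cosh(φ_u-φ_v)-1)]`.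
[cite: KomaTasakiPRL1992, eqs. (6)–(12), note 9 and footnote [10]] [cite: XuEtAl2024, eq. (1)] -/
theorem norm_thermalCorr_fermionProduct_ttPrime_le_exp_sharp (L : ℕ) [NeZero L]
    (t t' U μ : ℝ) {β : ℝ} (hβ : 0 ≤ β) (φ : TorusSite 2 L → ℝ) (x y : TorusSite 2 L)
    (l l' : List (TorusSite 2 L × Fin 2))
    (hx : ∀ p ∈ l, φ p.1 = φ x) (hy : ∀ p ∈ l', φ p.1 = φ y) :
    ‖(hubbardTorusTT' L t t' U - (μ : ℂ) • totalNumber).thermalCorr β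
        (torusFermionProduct l)ᴴ (torusFermionProduct l')‖ ≤
      Real.exp (-((l.length : ℝ) * φ x) + (l'.length : ℝ) * φ y) * Real.exp (β * (|t| *
          (∑ a : TorusSite 2 L, ∑ b : TorusSite 2 L,
            (if (torusGraph 2 L).Adj a b then (Real.cosh (φ a - φ b) - 1) else 0)) +
        |t'| * ∑ a : TorusSite 2 L, ∑ b : TorusSite 2 L,
            (if (torusDiagGraph L).Adj a b then (Real.cosh (φ a - φ b) - 1) else 0))) := by
  have key := norm_thermalCorr_fermionProduct_le_exp_two_graphs (fermionTorusGraph 2 L)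
    (fermionTorusDiagGraph L) t U μ t' 0 0 hβ (fun u => φ (FermionTorus.toTorusSite u))
    (l.map fun p => (FermionTorus.ofTorusSite p.1, p.2))
    (l'.map fun p => (FermionTorus.ofTorusSite p.1, p.2))
  have hsum₁ : (∑ u : FermionTorus 2 L, ∑ v : FermionTorus 2 L,
      if (fermionTorusGraph 2 L).Adj u v then
        (Real.cosh (φ (FermionTorus.toTorusSite u) - φ (FermionTorus.toTorusSite v)) - 1)
      else 0) =
      ∑ a : TorusSite 2 L, ∑ b : TorusSite 2 L,
        if (torusGraph 2 L).Adj a b then (Real.cosh (φ a - φ b) - 1) else 0 := by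
    refine Fintype.sum_equiv FermionTorus.equivTorusSite _ _ fun u => ?_
    refine Fintype.sum_equiv FermionTorus.equivTorusSite _ _ fun v => ?_
    simp [FermionTorus.equivTorusSite]
  have hsum₂ : (∑ u : FermionTorus 2 L, ∑ v : FermionTorus 2 L,
      if (fermionTorusDiagGraph L).Adj u v then
        (Real.cosh (φ (FermionTorus.toTorusSite u) - φ (FermionTorus.toTorusSite v)) - 1)
      else 0) =
      ∑ a : TorusSite 2 L, ∑ b : TorusSite 2 L,
        if (torusDiagGraph L).Adj a b then (Real.cosh (φ a - φ b) - 1) else 0 := by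
    refine Fintype.sum_equiv FermionTorus.equivTorusSite _ _ fun u => ?_
    refine Fintype.sum_equiv FermionTorus.equivTorusSite _ _ fun v => ?_
    simp [FermionTorus.equivTorusSite, fermionTorusDiagGraph, SimpleGraph.comap_adj]
  rw [hsum₁, hsum₂, gaugeWeight_map_ofTorusSite, gaugeWeight_map_ofTorusSite,
    sum_map_eq_length_mul φ (φ x) l hx, sum_map_eq_length_mul φ (φ y) l' hy,
    ← hubbardTorusTT'_sub_chemicalPotential] at key
  unfold torusFermionProduct
  refine Eq.trans_le ?_ (key.trans_eq ?_)
  · congr!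
  · ring

/-! ### Koma–Tasaki's `P_x = c_{x+δ₁,σ₁} ⋯ c_{x+δ_n,σ_n}` and the sharp power laws -/

/-- **Koma–Tasaki's general pairing operator on the torus** (footnote [10]):
`P_x = c_{x+δ₁,σ₁} c_{x+δ₂,σ₂} ⋯ c_{x+δ_n,σ_n}` for fixed lattice vectors `δ_i` (computed in
`(ℤ/Lℤ)²`) and fixed spins `σ_i` (Koma–Tasaki normalise `δ₁ = 0`).
[cite: KomaTasakiPRL1992, footnote [10]] -/
def multiFermion {n : ℕ} (δ : Fin n → Site 2) (σ : Fin n → Fin 2) (L : ℕ) [NeZero L]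
    (x : TorusSite 2 L) :
    Matrix (Finset (Orb (FermionTorus 2 L))) (Finset (Orb (FermionTorus 2 L))) ℂ :=
  torusFermionProduct (List.ofFn fun i => (x + Torus.proj L (δ i), σ i))

/-- For a step `e ∈ {0, ±e₁, ±e₂}`, `|proj e|₂² ≤ 1` on `(ℤ/Lℤ)²`. [folklore] -/
private theorem torusNormSq_proj_le_oneM (L : ℕ) [NeZero L] {e : Site 2}
    (he : e ∈ insert (0 : Site 2) unitSteps) : torusNormSq (Torus.proj L e) ≤ 1 := by
  have hmax : torusNorm (Torus.proj L e : TorusSite 2 L) ≤ 1 :=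
    torusNorm_proj_le_one L (apply_mem_insert_unitSteps he)
  rw [torusNorm_two_eq_max] at hmax
  have h0 : min ((Torus.proj L e : TorusSite 2 L) 0).val
      (L - ((Torus.proj L e : TorusSite 2 L) 0).val) ≤ 1 := le_trans (le_max_left _ _) hmax
  have h1 : min ((Torus.proj L e : TorusSite 2 L) 1).val
      (L - ((Torus.proj L e : TorusSite 2 L) 1).val) ≤ 1 := le_trans (le_max_right _ _) hmax
  have hz : e 0 = 0 ∨ e 1 = 0 := by
    simp only [unitSteps, mem_insert, mem_singleton] at he
    rcases he with rfl | rfl | rfl | rfl | rfl <;> simp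
  unfold torusNormSq
  rcases hz with h | h
  · have hc : ((Torus.proj L e : TorusSite 2 L) 0) = 0 := by simp [Torus.proj_apply, h]
    have hm0 : min (0 : ℕ) (L - 0) = 0 := by simp
    rw [hc, ZMod.val_zero, hm0]
    simpa using Nat.pow_le_pow_left h1 2
  · have hc : ((Torus.proj L e : TorusSite 2 L) 1) = 0 := by simp [Torus.proj_apply, h]
    have hm0 : min (0 : ℕ) (L - 0) = 0 := by simp
    rw [hc, ZMod.val_zero, hm0]
    simpa using Nat.pow_le_pow_left h0 2

/-- The support of `P_x` lies in the unit `|·|₂`-neighbourhood of `x` when all steps are in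
`{0, ±e₁, ±e₂}`: a potential flat there is constant on the support. [folklore] -/
private theorem flat_on_ofFn (L : ℕ) [NeZero L] {n : ℕ} (δ : Fin n → Site 2) (σ : Fin n → Fin 2)
    (hδ : ∀ i, δ i ∈ insert (0 : Site 2) unitSteps) (φ : TorusSite 2 L → ℝ) (x : TorusSite 2 L)
    (hflat : ∀ u, torusNormSq (u - x) ≤ 1 → φ u = φ x) :
    ∀ p ∈ (List.ofFn fun i => (x + Torus.proj L (δ i), σ i)), φ p.1 = φ x := by
  intro p hp
  rw [List.mem_ofFn] at hp
  obtain ⟨i, rfl⟩ := hp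
  refine hflat _ ?_
  rw [add_sub_cancel_left]
  exact torusNormSq_proj_le_oneM L (hδ i)

/-- **Sharp Koma–Tasaki bound for general `n`-fermion pairing operators on `(ℤ/Lℤ)²`**
(Theorem, eq. (2), in the generality of footnote [10], printed hopping norm, Euclidean dipole):
for all real `t, U, μ`, `β ≥ 0`, every `q ≥ 0` with `f := 2nq - 4πβ|t|q² ≥ 0`, steps
`δ_i, δ'_i ∈ {0, ±e₁, ±e₂}`, arbitrary spins, and all sites `x, y`:
`|⟨(P_x)† P'_y⟩_{β,L}| ≤ K(q) 5^f (dist(x,y)+1)^{-f}`, `K(q) = exp[2β|t|(2πq²+76q²+544q⁴e^{2q²})]`,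
uniformly in `L`; at `q = n/(4πβ|t|)`, `f = n²/(4πβ|t|)` (`n = 1, 2, 4`: one electron, pairs,
quartets). [cite: KomaTasakiPRL1992, Theorem eq. (2), footnote [10], eqs. (5)–(13)] [cite: McBryanSpencer1977] -/
theorem norm_thermalCorr_multiFermion_le_sharp (L : ℕ) [NeZero L] {n : ℕ}
    (δ δ' : Fin n → Site 2) (σ σ' : Fin n → Fin 2)
    (hδ : ∀ i, δ i ∈ insert (0 : Site 2) unitSteps) (hδ' : ∀ i, δ' i ∈ insert (0 : Site 2) unitSteps)
    (t U μ β q : ℝ) (hβ : 0 ≤ β) (hq : 0 ≤ q)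
    (hf : 0 ≤ 2 * n * q - 4 * Real.pi * (β * |t|) * q ^ 2) (x y : TorusSite 2 L) :
    ‖(hubbardTorusWith 2 L t U μ).thermalCorr β
        (multiFermion δ σ L x)ᴴ (multiFermion δ' σ' L y)‖ ≤
      Real.exp (2 * (β * |t|) *
          (2 * Real.pi * q ^ 2 + 76 * q ^ 2 + 544 * q ^ 4 * Real.exp (2 * q ^ 2))) *
        ((5 : ℝ) ^ (2 * n * q - 4 * Real.pi * (β * |t|) * q ^ 2) *
          ((torusDist x y : ℝ) + 1) ^ (-(2 * n * q - 4 * Real.pi * (β * |t|) * q ^ 2))) := by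
  refine le_rpow_euclid_of_apriori_flat L (β * |t|) n q _ _ (mul_nonneg hβ (abs_nonneg t)) hq
    x y (fun φ hfx hfy => ?_) (by ring) hf
  have h := norm_thermalCorr_fermionProduct_torus_le_exp_sharp t U μ hβ φ x y
    (List.ofFn fun i => (x + Torus.proj L (δ i), σ i))
    (List.ofFn fun i => (y + Torus.proj L (δ' i), σ' i))
    (flat_on_ofFn L δ σ hδ φ x hfx) (flat_on_ofFn L δ' σ' hδ' φ y hfy)
  rw [List.length_ofFn, List.length_ofFn] at h
  have he : -((n : ℝ) * φ x) + (n : ℝ) * φ y = -((n : ℝ) * (φ x - φ y)) := by ring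
  rw [he] at h
  unfold multiFermion
  exact h

/-- **A priori: `|⟨(P_x)† P'_y⟩_{β,L}| ≤ 1`** (`φ = 0`; `‖P‖ ≤ 1`).
[cite: KomaTasakiPRL1992, eq. (10) and footnote [10]] -/
theorem norm_thermalCorr_multiFermion_le_one (L : ℕ) [NeZero L] {n : ℕ}
    (δ δ' : Fin n → Site 2) (σ σ' : Fin n → Fin 2) (t U μ β : ℝ) (hβ : 0 ≤ β)
    (x y : TorusSite 2 L) :
    ‖(hubbardTorusWith 2 L t U μ).thermalCorr β
        (multiFermion δ σ L x)ᴴ (multiFermion δ' σ' L y)‖ ≤ 1 := by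
  have h := norm_thermalCorr_fermionProduct_torus_le_exp_sharp t U μ hβ (fun _ => 0) x y
    (List.ofFn fun i => (x + Torus.proj L (δ i), σ i))
    (List.ofFn fun i => (y + Torus.proj L (δ' i), σ' i)) (fun _ _ => rfl) (fun _ _ => rfl)
  unfold multiFermion
  simpa using h

/-- **Sharp Koma–Tasaki bound for general `n`-fermion pairing operators of the `t–t'` Hubbard
model** (note 9, footnote [10]; the flat Euclidean dipole on BOTH bond graphs): for all real
`t, t', U, μ`, `β ≥ 0`, every `q ≥ 0` with `f := 2nq - 4πβ(|t|+2|t'|)q² ≥ 0`, steps in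
`{0, ±e₁, ±e₂}`, arbitrary spins, all `x, y`:
`|⟨(P_x)† P'_y⟩_{β,L}| ≤ K_{t,t'}(q) 5^f (dist(x,y)+1)^{-f}`,
`K_{t,t'}(q) = exp[2β(|t|(2πq²+76q²+544q⁴e^{2q²}) + |t'|(4πq²+289q²+3402q⁴e^{2q²}))]`; at
`q = n/(4πβ(|t|+2|t'|))`, `f = n²/(4πβ(|t|+2|t'|))`.
[cite: KomaTasakiPRL1992, Theorem eq. (2), note 9, footnote [10]] [cite: XuEtAl2024, eq. (1)] [cite: McBryanSpencer1977] -/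
theorem norm_thermalCorr_multiFermion_ttPrime_le_sharp (L : ℕ) [NeZero L] {n : ℕ}
    (δ δ' : Fin n → Site 2) (σ σ' : Fin n → Fin 2)
    (hδ : ∀ i, δ i ∈ insert (0 : Site 2) unitSteps) (hδ' : ∀ i, δ' i ∈ insert (0 : Site 2) unitSteps)
    (t t' U μ β q : ℝ) (hβ : 0 ≤ β) (hq : 0 ≤ q)
    (hf : 0 ≤ 2 * n * q - 4 * Real.pi * (β * (|t| + 2 * |t'|)) * q ^ 2) (x y : TorusSite 2 L) :
    ‖(hubbardTorusTT' L t t' U - (μ : ℂ) • totalNumber).thermalCorr β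
        (multiFermion δ σ L x)ᴴ (multiFermion δ' σ' L y)‖ ≤
      Real.exp (2 * β * (|t| * (2 * Real.pi * q ^ 2 + 76 * q ^ 2 +
            544 * q ^ 4 * Real.exp (2 * q ^ 2)) +
          |t'| * (4 * Real.pi * q ^ 2 + 289 * q ^ 2 + 3402 * q ^ 4 * Real.exp (2 * q ^ 2)))) *
        ((5 : ℝ) ^ (2 * n * q - 4 * Real.pi * (β * (|t| + 2 * |t'|)) * q ^ 2) *
          ((torusDist x y : ℝ) + 1) ^
            (-(2 * n * q - 4 * Real.pi * (β * (|t| + 2 * |t'|)) * q ^ 2))) := by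
  refine le_rpow_euclid_two_graphs_of_apriori_flat L β |t| |t'| n q _ _ hβ (abs_nonneg t)
    (abs_nonneg t') hq x y (fun φ hfx hfy => ?_) (by ring) hf
  have h := norm_thermalCorr_fermionProduct_ttPrime_le_exp_sharp L t t' U μ hβ φ x y
    (List.ofFn fun i => (x + Torus.proj L (δ i), σ i))
    (List.ofFn fun i => (y + Torus.proj L (δ' i), σ' i))
    (flat_on_ofFn L δ σ hδ φ x hfx) (flat_on_ofFn L δ' σ' hδ' φ y hfy)
  rw [List.length_ofFn, List.length_ofFn] at h
  have he : -((n : ℝ) * φ x) + (n : ℝ) * φ y = -((n : ℝ) * (φ x - φ y)) := by ring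
  rw [he] at h
  unfold multiFermion
  exact h

/-- **A priori for the `t–t'` model: `|⟨(P_x)† P'_y⟩_{β,L}| ≤ 1`.**
[cite: KomaTasakiPRL1992, eq. (10), note 9 and footnote [10]] -/
theorem norm_thermalCorr_multiFermion_ttPrime_le_one (L : ℕ) [NeZero L] {n : ℕ}
    (δ δ' : Fin n → Site 2) (σ σ' : Fin n → Fin 2) (t t' U μ β : ℝ) (hβ : 0 ≤ β)
    (x y : TorusSite 2 L) :
    ‖(hubbardTorusTT' L t t' U - (μ : ℂ) • totalNumber).thermalCorr β
        (multiFermion δ σ L x)ᴴ (multiFermion δ' σ' L y)‖ ≤ 1 := by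
  have h := norm_thermalCorr_fermionProduct_ttPrime_le_exp_sharp L t t' U μ hβ (fun _ => 0) x y
    (List.ofFn fun i => (x + Torus.proj L (δ i), σ i))
    (List.ofFn fun i => (y + Torus.proj L (δ' i), σ' i)) (fun _ _ => rfl) (fun _ _ => rfl)
  unfold multiFermion
  simpa using h

end Torus

end Literature.MathematicalPhysics.QuantumLattice

end
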